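import Summits.Parity.GeneralizedHardyLittlewood.Theorems.ChenParityOracleBLAPHostParityFromBrickTypeISwitch
import Literature.NumberTheory.Sieve.BombieriVinogradovLiouvilleHeights
import HarnessLib

/-!
# Route `ChenParityOracleBLAP` — crux S1 = `HostParityFromBrick` (stmt-Parity-20045): Type-I sums, small moduli `d`

Support file for the prime half `K1 → K2 → HP1` of S1 (the unconditional Type-I input).  After the
divisor switch (file `…TypeISwitch`), the Type-I congruence sums for a FIXED odd `d ≤ x^{1/3+ε_T}`
are sums of `λ` over `v ≤ V(d,r) ≤ (x+2)/d` in one reduced class modulo `2r`, `r ≤ R ≤ x^{1/3−ε_T}`;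
summed over `r` they are an instance of the Bombieri–Vinogradov theorem for `λ` with per-modulus
heights (`Literature.NumberTheory.Sieve.BVLiouvilleHeights.bv_liouvilleAP`, PROVED in the tree) at
`X = (x+2)/d ≥ x^{2/3−ε_T}`, level `2R ≤ X^{1/2}/(log X)^B`:
`∑_{r ≤ R, r odd, (d,r)=1} |∑_{v ≤ V(d,r), v ≡ l(d,r) (2r)} λ(v)| ≤ C (x/d)/(log x)^A`
(`typeI_small_d`).

References: H. Iwaniec, E. Kowalski, *Analytic Number Theory* (2004), Thm 17.4
[IwaniecKowalski2004]; E. Bombieri, J. B. Friedlander, H. Iwaniec, Acta Math. 156 (1986)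
[BombieriFriedlanderIwaniecActa1986].
-/

namespace Summit.Parity.GeneralizedHardyLittlewood.Theorems

open Finset Real Filter
open ArithmeticFunction (liouville)

/-- **Type-I sums for small `d` by Bombieri–Vinogradov for `λ`.**  For `A > 0`, `0 < ε_T ≤ 1/6`
there are `C ≥ 0`, `x₀` such that for all `x ≥ x₀`, `u ≤ x`, `R ≤ x^{1/3−ε_T}`, every residue
selector `lf` (odd, reduced: `r ∣ d·lf(d,r) − 2`), and every odd `d` with `1 ≤ d ≤ x^{1/3+ε_T}`:
`∑_{r ≤ R, r odd, (d,r)=1} |∑_{v ≤ (r⌊u/r⌋+2)/d, v ≡ lf(d,r) (2r)} λ(v)| ≤ C (x/d)/(log x)^A`. -/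
theorem typeI_small_d (A εT : ℝ) (hA : 0 < A) (hεT : 0 < εT) (hεT' : εT ≤ 1 / 6) :
    ∃ C x₀ : ℝ, 0 ≤ C ∧ ∀ x : ℕ, x₀ ≤ (x : ℝ) → ∀ u : ℕ, u ≤ x → ∀ R : ℕ,
      (R : ℝ) ≤ (x : ℝ) ^ (1 / 3 - εT) → ∀ lf : ℕ → ℕ → ℕ,
      (∀ d r : ℕ, Odd r → Nat.Coprime d r → Odd (lf d r) ∧ (r : ℤ) ∣ (d : ℤ) * (lf d r) - 2) →
      ∀ d : ℕ, Odd d → 1 ≤ d → (d : ℝ) ≤ (x : ℝ) ^ (1 / 3 + εT) →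
      ∑ r ∈ (Icc 1 R).filter (fun r => Odd r ∧ Nat.Coprime d r),
        |∑ v ∈ (Icc 1 ((r * (u / r) + 2) / d)).filter
            (fun v : ℕ => (v : ZMod (2 * r)) = ((lf d r : ℕ) : ZMod (2 * r))), (liouville v : ℝ)| ≤
        C * ((x : ℝ) / d) / Real.log x ^ A := by
  classical
  obtain ⟨B, C, x₁, hB, hC, hBV⟩ :=
    Literature.NumberTheory.Sieve.BVLiouvilleHeights.bv_liouvilleAP A hA
  -- eventually: `x ≥ 16`, `x^{2/3-εT} ≥ x₁`, `2 (log (2x))^B ≤ x^{εT/2}`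
  have hev : ∀ᶠ y : ℝ in atTop, 16 ≤ y ∧ x₁ ≤ y ^ (2 / 3 - εT) ∧
      2 * Real.log (2 * y) ^ B ≤ y ^ (εT / 2) := by
    refine (eventually_ge_atTop 16).and (((tendsto_rpow_atTop (by linarith)).eventually_ge_atTop _).and ?_)
    -- `(log 2y)^B ≤ (2 log y)^B = 2^B (log y)^B` and `(log y)^B = o(y^{εT/2})`
    have h := (isLittleO_log_rpow_rpow_atTop B (by positivity : (0:ℝ) < εT / 2)).bound
      (show (0:ℝ) < 1 / (2 * 2 ^ B) by positivity)
    filter_upwards [h, eventually_ge_atTop (2 : ℝ)] with y hy hy2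
    have hl : 0 < Real.log y := Real.log_pos (by linarith)
    rw [Real.norm_of_nonneg (Real.rpow_nonneg hl.le _),
      Real.norm_of_nonneg (Real.rpow_nonneg (by linarith) _)] at hy
    have hl2 : 0 ≤ Real.log (2 * y) := Real.log_nonneg (by linarith)
    have h2y : Real.log (2 * y) ≤ 2 * Real.log y := by
      rw [Real.log_mul (by norm_num) (by linarith)]
      have : Real.log 2 ≤ Real.log y := Real.log_le_log (by norm_num) hy2
      linarith
    calc 2 * Real.log (2 * y) ^ B ≤ 2 * (2 * Real.log y) ^ B := by
          gcongr
      _ = 2 * 2 ^ B * Real.log y ^ B := by rw [Real.mul_rpow (by norm_num) hl.le]; ring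
      _ ≤ 2 * 2 ^ B * (1 / (2 * 2 ^ B) * y ^ (εT / 2)) := by gcongr
      _ = y ^ (εT / 2) := by field_simp
  obtain ⟨x₀, hx₀⟩ := Filter.eventually_atTop.mp hev
  refine ⟨C * 2 * 2 ^ A, x₀, by positivity, ?_⟩
  intro x hx u hu R hR lf hlf d hd hd1 hdx
  obtain ⟨hx16, hx₁, hlogB⟩ := hx₀ x hx
  have hx0 : (0 : ℝ) < x := by linarith
  have hx1 : (1 : ℝ) ≤ x := by linarith
  have hd0 : (0 : ℝ) < d := by exact_mod_cast hd1
  set X : ℝ := ((x : ℝ) + 2) / d with hXdef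
  -- `X ≥ x^{2/3-εT} ≥ x₁`
  have hXge : (x : ℝ) ^ (2 / 3 - εT) ≤ X := by
    rw [hXdef, le_div_iff₀ hd0]
    calc (x : ℝ) ^ (2 / 3 - εT) * d ≤ (x : ℝ) ^ (2 / 3 - εT) * (x : ℝ) ^ (1 / 3 + εT) :=
          mul_le_mul_of_nonneg_left hdx (by positivity)
      _ = x := by rw [← Real.rpow_add hx0]; norm_num
      _ ≤ x + 2 := by linarith
  have hXx₁ : x₁ ≤ X := hx₁.trans hXge
  have hX0 : 0 < X := by rw [hXdef]; positivity
  have hXle : X ≤ (x : ℝ) + 2 := by rw [hXdef]; exact div_le_self (by positivity) (by exact_mod_cast hd1)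
  -- `log X ≥ (1/2) log x`
  have hlogX : Real.log x / 2 ≤ Real.log X := by
    have h1 : Real.log ((x : ℝ) ^ (2 / 3 - εT)) ≤ Real.log X := Real.log_le_log (by positivity) hXge
    rw [Real.log_rpow hx0] at h1
    have hl0 : 0 ≤ Real.log x := Real.log_nonneg hx1
    nlinarith
  have hlogx0 : 0 < Real.log x := Real.log_pos (by linarith)
  have hlogX0 : 0 < Real.log X := by linarith
  -- the level: `2R ≤ X^{1/2}/(log X)^B`
  have hQ : ((2 * R : ℕ) : ℝ) ≤ X ^ (1 / 2 : ℝ) / Real.log X ^ B := by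
    have hXhalf : (x : ℝ) ^ (1 / 3 - εT / 2) ≤ X ^ (1 / 2 : ℝ) := by
      have : ((x : ℝ) ^ (2 / 3 - εT)) ^ (1 / 2 : ℝ) ≤ X ^ (1 / 2 : ℝ) :=
        Real.rpow_le_rpow (by positivity) hXge (by norm_num)
      rw [← Real.rpow_mul hx0.le] at this
      convert this using 2; ring
    have hlogXle : Real.log X ^ B ≤ Real.log (2 * x) ^ B := by
      refine Real.rpow_le_rpow hlogX0.le (Real.log_le_log hX0 (hXle.trans (by linarith))) hB.le
    rw [le_div_iff₀ (Real.rpow_pos_of_pos hlogX0 _)]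
    push_cast
    calc 2 * (R : ℝ) * Real.log X ^ B ≤ 2 * (x : ℝ) ^ (1 / 3 - εT) * Real.log (2 * x) ^ B := by
          gcongr
      _ = (x : ℝ) ^ (1 / 3 - εT) * (2 * Real.log (2 * x) ^ B) := by ring
      _ ≤ (x : ℝ) ^ (1 / 3 - εT) * (x : ℝ) ^ (εT / 2) := mul_le_mul_of_nonneg_left hlogB (by positivity)
      _ = (x : ℝ) ^ (1 / 3 - εT / 2) := by rw [← Real.rpow_add hx0]; ring_nf
      _ ≤ X ^ (1 / 2 : ℝ) := hXhalf
  -- heights and residues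
  set good : ℕ → Prop := fun q => Even q ∧ Odd (q / 2) ∧ Nat.Coprime d (q / 2) with hgood
  set N : ℕ → ℕ := fun q => if good q then (q / 2 * (u / (q / 2)) + 2) / d else 0 with hN
  set a : (q : ℕ) → ZMod q := fun q => if good q then ((lf d (q / 2) : ℕ) : ZMod q) else 1 with ha
  have hNle : ∀ q, (N q : ℝ) ≤ X := by
    intro q
    simp only [hN]
    split_ifs with hq
    · rw [hXdef, le_div_iff₀ hd0]
      have h1 : ((q / 2 * (u / (q / 2)) + 2) / d : ℕ) * d ≤ q / 2 * (u / (q / 2)) + 2 := Nat.div_mul_le_self _ _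
      have h2 : q / 2 * (u / (q / 2)) ≤ u := Nat.mul_div_le u (q / 2)
      have h3 : (((q / 2 * (u / (q / 2)) + 2) / d : ℕ) : ℝ) * d ≤ (u : ℝ) + 2 := by
        exact_mod_cast (h1.trans (by omega))
      have hux : (u : ℝ) ≤ x := by exact_mod_cast hu
      linarith
    · simp only [Nat.cast_zero]; exact hX0.le
  have hunit : ∀ q ∈ Icc 1 (2 * R), IsUnit (a q) := by
    intro q hq
    simp only [ha]
    split_ifs with hg
    · obtain ⟨hqe, hqo, hqc⟩ := hg
      obtain ⟨hlo, hlr⟩ := hlf d (q / 2) hqo hqc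
      have hq2 : q = 2 * (q / 2) := by obtain ⟨k, hk⟩ := hqe; omega
      have hcop := coprime_of_switch_residue hlo hlr
      rw [← hq2] at hcop
      exact (ZMod.isUnit_iff_coprime _ _).mpr hcop
    · exact isUnit_one
  have hBVx := hBV X hXx₁ (2 * R) hQ N hNle a hunit
  -- our sum is a sub-sum of the BV sum (moduli `q = 2r`)
  have hsub : ∑ r ∈ (Icc 1 R).filter (fun r => Odd r ∧ Nat.Coprime d r),
      |∑ v ∈ (Icc 1 ((r * (u / r) + 2) / d)).filter
        (fun v : ℕ => (v : ZMod (2 * r)) = ((lf d r : ℕ) : ZMod (2 * r))), (liouville v : ℝ)| ≤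
      ∑ q ∈ Icc 1 (2 * R), |∑ m ∈ (Icc 1 (N q)).filter (fun m : ℕ => (m : ZMod q) = a q),
        (liouville m : ℝ)| := by
    set F := (Icc 1 R).filter (fun r => Odd r ∧ Nat.Coprime d r) with hF
    set T : ℕ → ℝ := fun q => |∑ m ∈ (Icc 1 (N q)).filter (fun m : ℕ => (m : ZMod q) = a q),
        (liouville m : ℝ)| with hT
    have hinj : Set.InjOn (fun r : ℕ => 2 * r) (F : Set ℕ) := fun a _ b _ h => by simpa using h
    have heq : ∑ r ∈ F, |∑ v ∈ (Icc 1 ((r * (u / r) + 2) / d)).filter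
        (fun v : ℕ => (v : ZMod (2 * r)) = ((lf d r : ℕ) : ZMod (2 * r))), (liouville v : ℝ)| =
        ∑ q ∈ F.image (fun r : ℕ => 2 * r), T q := by
      rw [Finset.sum_image hinj]
      refine Finset.sum_congr rfl fun r hr => ?_
      rw [hF, Finset.mem_filter] at hr
      obtain ⟨-, hro, hrc⟩ := hr
      have hg : good (2 * r) := by
        refine ⟨even_two_mul r, ?_, ?_⟩ <;> rw [Nat.mul_div_cancel_left r two_pos]
        exacts [hro, hrc]
      have hNr : N (2 * r) = (r * (u / r) + 2) / d := by
        simp only [hN, if_pos hg, Nat.mul_div_cancel_left r two_pos]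
      have har : a (2 * r) = ((lf d r : ℕ) : ZMod (2 * r)) := by
        simp only [ha, if_pos hg, Nat.mul_div_cancel_left r two_pos]
      simp only [hT, hNr, har]
    rw [heq]
    refine Finset.sum_le_sum_of_subset_of_nonneg ?_ fun _ _ _ => by simp only [hT]; exact abs_nonneg _
    intro q hq
    rw [Finset.mem_image] at hq
    obtain ⟨r, hr, rfl⟩ := hq
    rw [hF, Finset.mem_filter, Finset.mem_Icc] at hr
    rw [Finset.mem_Icc]; omega
  refine hsub.trans (hBVx.trans ?_)
  -- `C X/(log X)^A ≤ C 2 2^A (x/d)/(log x)^A`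
  have hXle' : X ≤ 2 * ((x : ℝ) / d) := by
    rw [hXdef, div_le_iff₀ hd0]
    have : 2 * ((x : ℝ) / d) * d = 2 * x := by field_simp
    rw [this]; linarith
  have hlogpow : (Real.log x / 2) ^ A ≤ Real.log X ^ A := Real.rpow_le_rpow (by positivity) hlogX hA.le
  calc C * X / Real.log X ^ A ≤ C * (2 * ((x : ℝ) / d)) / (Real.log x / 2) ^ A := by
        have h1 : C * X / Real.log X ^ A ≤ C * (2 * ((x : ℝ) / d)) / Real.log X ^ A :=
          div_le_div_of_nonneg_right (mul_le_mul_of_nonneg_left hXle' hC) (by positivity)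
        exact h1.trans (div_le_div_of_nonneg_left (by positivity) (by positivity) hlogpow)
    _ = C * 2 * 2 ^ A * ((x : ℝ) / d) / Real.log x ^ A := by
        rw [Real.div_rpow hlogx0.le (by norm_num)]; field_simp

end Summit.Parity.GeneralizedHardyLittlewood.Theorems
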